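import Summits.BirchSwinnertonDyer.BirchSwinnertonDyer.Theorems.GenusKolyvaginAtTwoShaCardDvdPowAtTwoPosTOnCut
import HarnessLib

/-!
# Route `GenusKolyvaginAtTwo`, residual `OffCutResidualAtTwo` (stmt-BirchSwinnertonDyer-25503), pen LINE 24 «strict_def2», stub X⁼²
# (`KolyvaginExactAtTwoPosDiscT` at Tamagawa defect 2): SIZING OF THE UPPER HALF — the pair sandwich with a `4^(k+1)` budget gives
# `#Ш(E/K)[2^∞] ∣ 4^(M₀ + k)`, and at defect `d` the archimedean-bit budget is `4^(d+1)`: the upper half of X⁼² holds UP TO `d` BITS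

Seat `bsd-line-gk2-p3` g28 (PROVER seat 3/3, cell `bsd-f1-sign2`), `--supports stmt-BirchSwinnertonDyer-25503` (helper; closes nothing).
THEOREMS ONLY (no definition, no named fact, no `sorry`); standard axioms.  **BSD is NOT proved by this file; X⁼² / LINE 24 / 25503 are NOT
proved; no item is closed.**  Everything here is UNCONDITIONAL descent algebra with the `ℚ`-side `Ш`-exponent DISPLAYED as a hypothesis (the
B2Q shape of gk2-p3 g27's `…PairSandwichSignFree` / gk2-p5 g34's `…SupplyKernelsLossless` §1), i.e. a SIZING certificate for the window decision
director-bsd (495)/(498) asks of LINE 24 («the one proof risk = the defect-2 sandwich budget for the upper half — name it»; gk2-p4 g26 07:59Z (d)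
flagged it free for this lineage).

* §1 **`natCard_sha_dvd_pow_add_of_pair_of_frame`** — gk2-p3 g27's numerical closer `natCard_sha_dvd_pow_of_pair_of_frame` with a GENERAL budget:
  frame (`K` imaginary quadratic, `σ ≠ 1`, `E(K)[2] = 0`, `rank E(K) ≤ 1`, an anti-invariant `y` with `2^(M+1) ∤ y`), `Ш(T/ℚ)[2^∞] = 0` for the
  twin, `2^(M₀) · Ш(E/ℚ)[2^∞] = 0`, `#Ш(E/ℚ)[2] ≤ 4`, and the two relaxed indices with **`A · A′ ≤ 4^(k+1)`** ⟹ **`#Ш(E/K)[2^∞] ∣ 4^(M₀ + k)`**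
  (`2·#X ≤ 4^(M₀)·A·A′`, `#X` a power of `4` by Cassels–Tate).  `k = 0` is the original closer.
* §2 **`relIndex_mul_relIndex_le_pow_of_padicValNat_eq`** — the budget at Tamagawa defect `d` (`C(W)` odd, `ord₂ C(Wd) = d`, any sign of `Δ`):
  both relaxed indices `≤ 2^(d+1)` by the archimedean bit (gk2-p3 g18 `relIndex_sha_comap_resBaseChange_le_two_pow_succ_of_arch` / `…_twin_…`,
  pen g12 `archimedeanBit_sha_comap_resBaseChange`), so **`A · A′ ≤ 4^(d+1)`**.
* §3 **`natCard_primaryComponent_sha_baseChange_two_dvd_pow_add_of_defect`** — the decoupled on-cut upper half (g34 §1's shape) AT DEFECT `d`: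
  habitat `W` (`C(W)` odd, `ρ̄_{W,2}` onto), `K` odd `d_K` Heegner, frame datum with `P(1)` of infinite order and `2^(M+1) ∤ P(1)`, `w(E) = +1`,
  `rank E(ℚ) = 0`, `#Sel₂(E) ∣ 4` (so `#Ш(E/ℚ)[2] ≤ 4`), a twin `Wd` with `#Sel₂(Wd) = 2` and **`ord₂ C(Wd) = d`**, and the `ℚ`-side exponent `m`:
  **`#Ш(E/K)[2^∞] ∣ 4^(m + d)`**.  `…_of_defectTwo`: `d = 2` — **the upper half of X⁼² holds up to TWO bits** from the sandwich alone.
  READING FOR THE WINDOW: BSD predicts `#Ш(E/K)[2^∞] = 4^(M₀)` at every defect (`C(E/K) = C(E)²`; g34 `Lossless` §2), and the lower half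
  `4^(M₀) ∣ #Ш` is road (E4)⁺; so on a DEF-2 cell the sandwich pins `#Ш(E/K)[2^∞] ∈ {4^(M₀), 4^(M₀+1), 4^(M₀+2)}` (with `m = M₀` from B2Q) and X⁼²'s
  upper half needs EXACTLY the two identity-prime bits back: they sit in the relaxed indices `A, A′` (local norm indices `i_q(E) = i_q(E^(d_K))
  = 4` at the identity prime `q ∣ d_K`, on top of the two archimedean bits); whether the STRICT hypothesis and the Chebotarev choice `ρ_q = 2` of
  A⁼² cut `A · A′` from `4^3` down to `4` is a Kramer-exact count of the relaxed groups (Kramer 1981 Thm. 2 with its `Φ`-term), not a bound the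
  archimedean-bit lemmas deliver.  Size: L, as the pen said; not attempted here.

References: [Kramer1981] Thm. 1, Thm. 2, §2 Prop. 3; [GrossLMS1991] §5 (5.1)–(5.3); [McCallumLMS1991] §5 Cor. 5.6; [MilneADT2006] I Rem. 3.7,
Thm. 6.13; [SilvermanAEC2009] X.4.14.
-/

set_option autoImplicit false
set_option linter.dupNamespace false -- `Summit.<P>.<Sub>` repeats `BirchSwinnertonDyer` (D-0017)

noncomputable section

open scoped Classical

namespace Summit.BirchSwinnertonDyer.BirchSwinnertonDyer.Theorems.GenusExact.PlusDescent.DefectSizing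

open Literature.NumberTheory.EllipticCurves Literature.NumberTheory.GaloisRepresentations WeierstrassCurve NumberField
  IsDedekindDomain Field AddSubgroup Literature.NumberTheory.EllipticCurves.ModularForms
open Summit.BirchSwinnertonDyer.Rank1Residual
open Summit.BirchSwinnertonDyer.BirchSwinnertonDyer.Theorems.GenusExact.PlusDescent
open Summit.BirchSwinnertonDyer.BirchSwinnertonDyer.Theorems.GenusExact.RegularPlusDescent (archimedeanBit_sha_comap_resBaseChange
  relIndex_sha_comap_resBaseChange_le_two_pow_succ_of_arch relIndex_sha_comap_resBaseChange_twin_le_two_pow_succ_of_arch)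

/-! ## §1 The numerical closer with a general budget `4^(k+1)` -/

section Counts

variable (W : WeierstrassCurve ℚ) [W.IsElliptic] (K : Type) [Field K] [NumberField K]

/-- **`#Ш(E/K)[2^∞] ∣ 4^(M₀ + k)` from the frame, the `ℚ`-side exponent, the `2`-rank over `ℚ` and a budget `A · A′ ≤ 4^(k+1)`.**
gk2-p3 g27's `natCard_sha_dvd_pow_of_pair_of_frame` VERBATIM with the budget `≤ 4` replaced by `≤ 4^(k+1)`: `2 · #X ≤ #Ш(E/ℚ)[2^∞] · A · A′ ≤
4^(M₀) · 4^(k+1)` (the pair sandwich `finite_and_two_mul_natCard_sha_le_pair_of_frame`, the filtration count `#Y ≤ #Y[2]^(M₀) ≤ 4^(M₀)`), and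
`#X = 4^t` (Cassels–Tate over `K`) give `t ≤ M₀ + k`.  [cite: Kramer1981, Thm. 1, §2 Prop. 3, proof of Thm. 2] [cite: GrossLMS1991, §5 (5.1)–(5.3)]
[cite: McCallumLMS1991, §5 Cor. 5.6] -/
theorem natCard_sha_dvd_pow_add_of_pair_of_frame (hIQ : IsImaginaryQuadratic K) {σ : K ≃ₐ[ℚ] K} (hσ1 : σ ≠ 1)
    (h2tors : ∀ P : (W.baseChange K).toAffine.Point, (2 : ℤ) • P = 0 → P = 0)
    (hrk : (W.baseChange K).mordellWeilRank ≤ 1)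
    (y : (W.baseChange K).toAffine.Point) (M : ℕ)
    (hndiv : ∀ Q : (W.baseChange K).toAffine.Point, ((2 ^ (M + 1) : ℕ) : ℤ) • Q ≠ y)
    (hanti : IsOfFinAddOrder (Affine.Point.map (W' := W) (σ : K →ₐ[ℚ] K) y + y))
    [Finite (AddCommGroup.primaryComponent (↥W.sha) 2)]
    (hT0 : haveI := W.isElliptic_quadraticTwist (show (NumberField.discr K : ℚ) ≠ 0 by exact_mod_cast NumberField.discr_ne_zero K)
      ∀ x ∈ AddCommGroup.primaryComponent (↥(W.quadraticTwist (NumberField.discr K : ℚ)).sha) 2, x = 0)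
    (hne : (W.sha).relIndex (((W.baseChange K).sha).comap (resBaseChange W K)) ≠ 0)
    (hneT : haveI := W.isElliptic_quadraticTwist (show (NumberField.discr K : ℚ) ≠ 0 by exact_mod_cast NumberField.discr_ne_zero K)
      ((W.quadraticTwist (NumberField.discr K : ℚ)).sha).relIndex
        ((((W.quadraticTwist (NumberField.discr K : ℚ)).baseChange K).sha).comap
          (resBaseChange (W.quadraticTwist (NumberField.discr K : ℚ)) K)) ≠ 0)
    {k : ℕ}
    (hbudget : haveI := W.isElliptic_quadraticTwist (show (NumberField.discr K : ℚ) ≠ 0 by exact_mod_cast NumberField.discr_ne_zero K)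
      (W.sha).relIndex (((W.baseChange K).sha).comap (resBaseChange W K)) *
        ((W.quadraticTwist (NumberField.discr K : ℚ)).sha).relIndex
          ((((W.quadraticTwist (NumberField.discr K : ℚ)).baseChange K).sha).comap
            (resBaseChange (W.quadraticTwist (NumberField.discr K : ℚ)) K)) ≤ 4 ^ (k + 1))
    {M₀ : ℕ} (hexp : ∀ a ∈ AddCommGroup.primaryComponent (↥W.sha) 2, 2 ^ M₀ • a = 0)
    (h4 : Nat.card (AddSubgroup.torsionBy (↥W.sha) ((2 : ℕ) : ℤ)) ≤ 4) :
    Finite (AddCommGroup.primaryComponent (↥(W.baseChange K).sha) 2) ∧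
      Nat.card (AddCommGroup.primaryComponent (↥(W.baseChange K).sha) 2) ∣ 2 ^ (2 * (M₀ + k)) := by
  haveI : Fact (Nat.Prime 2) := ⟨Nat.prime_two⟩
  haveI hell : (W.baseChange K).IsElliptic := inferInstanceAs ((W.map (algebraMap ℚ K)).IsElliptic)
  have hdK : (NumberField.discr K : ℚ) ≠ 0 := by exact_mod_cast NumberField.discr_ne_zero K
  haveI hTell : (W.quadraticTwist (NumberField.discr K : ℚ)).IsElliptic := W.isElliptic_quadraticTwist hdK
  set T := W.quadraticTwist (NumberField.discr K : ℚ) with hTdef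
  set Y : AddSubgroup ↥W.sha := AddCommGroup.primaryComponent (↥W.sha) 2 with hY
  set Y' : AddSubgroup ↥T.sha := AddCommGroup.primaryComponent (↥T.sha) 2 with hY'
  -- `#Y' = 1`
  have hY'1 : Nat.card Y' = 1 := by
    rw [Nat.card_eq_one_iff_unique]
    refine ⟨⟨fun a b ↦ Subtype.ext ?_⟩, ⟨⟨0, AddSubgroup.zero_mem _⟩⟩⟩
    rw [hT0 a.1 a.2, hT0 b.1 b.2]
  haveI hfinT : Finite Y' := Nat.finite_of_card_ne_zero (by rw [hY'1]; exact one_ne_zero)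
  obtain ⟨hXfin, hle⟩ := finite_and_two_mul_natCard_sha_le_pair_of_frame W K hIQ hσ1 h2tors hrk y M hndiv hanti hfinT hne hneT
  refine ⟨hXfin, ?_⟩
  haveI := hXfin
  -- `#Y ≤ 4^(M₀)` by the filtration count
  have hYle : Nat.card Y ≤ 4 ^ M₀ := by
    have h := natCard_le_natCard_torsionBy_pow (A := Y) 2
      (fun x ↦ Subtype.ext (by rw [AddSubgroupClass.coe_nsmul, ZeroMemClass.coe_zero]; exact hexp x x.2))
    have hbr := CasselsTateNumberField.natCard_sha_torsionBy_pow_eq_primaryComponent W 2 1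
    rw [pow_one] at hbr
    rw [← hbr] at h
    calc Nat.card Y ≤ Nat.card (AddSubgroup.torsionBy (↥W.sha) ((2 : ℕ) : ℤ)) ^ M₀ := h
      _ ≤ 4 ^ M₀ := Nat.pow_le_pow_left h4 M₀
  -- `2 · #X ≤ 4^(M₀) · 4^(k+1)`
  have h2X : 2 * Nat.card (AddCommGroup.primaryComponent (↥(W.baseChange K).sha) 2) ≤ 4 ^ M₀ * 4 ^ (k + 1) := by
    calc 2 * Nat.card (AddCommGroup.primaryComponent (↥(W.baseChange K).sha) 2)
        ≤ (Nat.card Y * (W.sha).relIndex (((W.baseChange K).sha).comap (resBaseChange W K))) *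
            (Nat.card Y' * (T.sha).relIndex (((T.baseChange K).sha).comap (resBaseChange T K))) := hle
      _ = Nat.card Y * ((W.sha).relIndex (((W.baseChange K).sha).comap (resBaseChange W K)) *
            (T.sha).relIndex (((T.baseChange K).sha).comap (resBaseChange T K))) := by rw [hY'1, one_mul, mul_assoc]
      _ ≤ 4 ^ M₀ * 4 ^ (k + 1) := Nat.mul_le_mul hYle hbudget
  -- `#X = 4^t`, so `t ≤ M₀ + k`
  obtain ⟨e, he⟩ := exists_natCard_addPrimaryComponent_eq_pow (A := ↥(W.baseChange K).sha) 2
  obtain ⟨r, hr⟩ := CasselsTateNumberField.isSquare_natCard_primaryComponent_sha (W.baseChange K) 2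
  have hr2 : r * r = 2 ^ e := by rw [← hr, he]
  obtain ⟨t, -, rfl⟩ := (Nat.dvd_prime_pow Nat.prime_two).mp (⟨r, hr2.symm⟩ : r ∣ 2 ^ e)
  have ht : Nat.card (AddCommGroup.primaryComponent (↥(W.baseChange K).sha) 2) = 2 ^ (2 * t) := by rw [hr, ← pow_add, two_mul]
  rw [ht] at h2X ⊢
  have h2X' : 2 ^ (2 * t + 1) ≤ 2 ^ (2 * M₀ + 2 * (k + 1)) := by
    calc 2 ^ (2 * t + 1) = 2 * 2 ^ (2 * t) := by ring
      _ ≤ 4 ^ M₀ * 4 ^ (k + 1) := h2X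
      _ = 2 ^ (2 * M₀ + 2 * (k + 1)) := by
          rw [show (4 : ℕ) = 2 ^ 2 by norm_num, ← pow_mul, ← pow_mul, ← pow_add]
  have htM : 2 * t + 1 ≤ 2 * M₀ + 2 * (k + 1) := (Nat.pow_le_pow_iff_right (by norm_num)).mp h2X'
  exact Nat.pow_dvd_pow 2 (by omega)

end Counts

/-! ## §2 The budget at Tamagawa defect `d` (archimedean bit, any sign of `Δ`) -/

section Budgets

variable (W : WeierstrassCurve ℚ) [W.IsElliptic] [W.IsGloballyMinimal] (K : Type) [Field K] [NumberField K]

/-- **The budget at defect `d`: `A · A′ ≤ 4^(d+1)`.**  `W` globally minimal with `C(W)` odd, `K` imaginary quadratic with odd `d_K` and Heegner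
for `N_W`, `Wd = Cd • W^(d_K)` any model with `ord₂ C(Wd) = d`: both relaxed indices are non-zero and `≤ 2^(d+1)` (gk2-p3 g18's `…_of_arch`
bounds with the torsor-level archimedean bit of pen g12, `archimedeanBit_sha_comap_resBaseChange`), hence their product is `≤ 4^(d+1)`.  At `d = 0`
this is gk2-p3 g27's `relIndex_mul_relIndex_le_four_of_padicValNat_eq_zero`.  [cite: Kramer1981, §2 Prop. 3 and Thm. 1] [cite: MilneADT2006, I Rem. 3.7] -/
theorem relIndex_mul_relIndex_le_pow_of_padicValNat_eq (hIQ : IsImaginaryQuadratic K) (hodd : Odd (NumberField.discr K))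
    (hHe : SatisfiesHeegnerHypothesis (W.conductorNorm ℤ) K) (hT : Odd W.tamagawaProduct)
    {Wd : WeierstrassCurve ℚ} [Wd.IsElliptic] (Cd : VariableChange ℚ) (hWd : Cd • W.quadraticTwist (NumberField.discr K : ℚ) = Wd)
    {d : ℕ} (hDEF : padicValNat 2 Wd.tamagawaProduct = d) :
    haveI := W.isElliptic_quadraticTwist (show (NumberField.discr K : ℚ) ≠ 0 by exact_mod_cast NumberField.discr_ne_zero K)
    (W.sha).relIndex (((W.baseChange K).sha).comap (resBaseChange W K)) ≠ 0 ∧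
      ((W.quadraticTwist (NumberField.discr K : ℚ)).sha).relIndex
          ((((W.quadraticTwist (NumberField.discr K : ℚ)).baseChange K).sha).comap
            (resBaseChange (W.quadraticTwist (NumberField.discr K : ℚ)) K)) ≠ 0 ∧
      (W.sha).relIndex (((W.baseChange K).sha).comap (resBaseChange W K)) *
        ((W.quadraticTwist (NumberField.discr K : ℚ)).sha).relIndex
          ((((W.quadraticTwist (NumberField.discr K : ℚ)).baseChange K).sha).comap
            (resBaseChange (W.quadraticTwist (NumberField.discr K : ℚ)) K)) ≤ 4 ^ (d + 1) := by
  have hdK : (NumberField.discr K : ℚ) ≠ 0 := by exact_mod_cast NumberField.discr_ne_zero K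
  haveI hTell : (W.quadraticTwist (NumberField.discr K : ℚ)).IsElliptic := W.isElliptic_quadraticTwist hdK
  obtain ⟨hne, hle⟩ := relIndex_sha_comap_resBaseChange_le_two_pow_succ_of_arch W K hIQ hodd hHe hT Cd hWd
    (archimedeanBit_sha_comap_resBaseChange W K)
  obtain ⟨hne', hle'⟩ := relIndex_sha_comap_resBaseChange_twin_le_two_pow_succ_of_arch W K hIQ hodd hHe hT
    (Wd := W.quadraticTwist (NumberField.discr K : ℚ)) 1 (one_smul _ _)
    (archimedeanBit_sha_comap_resBaseChange (W.quadraticTwist (NumberField.discr K : ℚ)) K)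
  have heq : padicValNat 2 (W.quadraticTwist (NumberField.discr K : ℚ)).tamagawaProduct = padicValNat 2 Wd.tamagawaProduct := by
    have h1 := prod_ncard_roots_add_one_eq_two_pow_padicValNat_tamagawaProduct_twin W hIQ hodd hHe hT
      (Wd := W.quadraticTwist (NumberField.discr K : ℚ)) 1 (one_smul _ _)
    have h2' := prod_ncard_roots_add_one_eq_two_pow_padicValNat_tamagawaProduct_twin W hIQ hodd hHe hT Cd hWd
    exact Nat.pow_right_injective le_rfl (h1.symm.trans h2')
  rw [heq] at hle'
  rw [hDEF] at hle hle'
  refine ⟨hne, hne', ?_⟩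
  calc _ ≤ 2 ^ (d + 1) * 2 ^ (d + 1) := Nat.mul_le_mul hle hle'
    _ = 4 ^ (d + 1) := by rw [← mul_pow]; norm_num

end Budgets

/-! ## §3 The decoupled on-cut upper half at defect `d`; the defect-2 sizing of LINE 24's X⁼² -/

section Defect

variable (W : WeierstrassCurve ℚ) [W.IsElliptic] [W.IsGloballyMinimal] [NeZero (W.conductorNorm ℤ)]
  (K : Type) [Field K] [NumberField K]

/-- **THE UPPER HALF AT TAMAGAWA DEFECT `d`, UP TO `d` BITS.**  `W/ℚ` globally minimal, `C(W)` odd, `ρ̄_{W,2}` onto; `K` imaginary quadratic,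
`d_K` odd, Heegner for `N_W`; a frame `(Dt, β, ι)`, a conductor-`1` datum `d₁` with `P(1)` of infinite order and `2^(M+1) ∤ P(1)`; `w(E) = +1`,
`rank E(ℚ) = 0`, `#Sel₂(E/ℚ) ∣ 4`; an elliptic `Wd ≅ E^(d_K)` with `#Sel₂(Wd) = 2` and **`ord₂ C(Wd) = d`** (any sign of `Δ`); and a `ℚ`-side
exponent `m` (every `2`-power-torsion `a ∈ Ш(E/ℚ)` has `2^m a = 0`).  Then **`#Ш(E/K)[2^∞] ∣ 4^(m + d)`**.  = gk2-p5 g34's decoupled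
`natCard_primaryComponent_sha_baseChange_two_dvd_pow_of_shaExponent` with the defect-`0`/`1` budget replaced by §2 and the closer by §1.
Unconditional descent algebra; the Kolyvagin input (`m`) is DISPLAYED.  [cite: Kramer1981, Thm. 1, §2 Prop. 3] [cite: GrossLMS1991, §5 Prop. 5.3]
[cite: McCallumLMS1991, §5 Cor. 5.6] -/
theorem natCard_primaryComponent_sha_baseChange_two_dvd_pow_add_of_defect
    (hT : Odd W.tamagawaProduct) (hIQ : IsImaginaryQuadratic K) (hodd : Odd (NumberField.discr K))
    (hHe : SatisfiesHeegnerHypothesis (W.conductorNorm ℤ) K) (hs2 : W.HasSurjectiveModNGaloisRep 2)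
    (Dt : ModularParametrizationData W (W.conductorNorm ℤ)) (β : ℤ) (ι : K →+* ℂ) (d₁ : KolyvaginHeegnerData Dt β ι 1)
    (hy : ¬ IsOfFinAddOrder d₁.derivedPoint) (M : ℕ)
    (hndiv : ¬ ∃ Q : (W.baseChange (ringClassField K ι 1)).toAffine.Point, ((2 ^ (M + 1) : ℕ) : ℤ) • Q = d₁.derivedPoint)
    (hw : W.rootNumber = 1) (hrk0 : W.mordellWeilRank = 0) (hSel4 : Nat.card (W.selmerGroup 2) ∣ 4)
    (Wd : WeierstrassCurve ℚ) [Wd.IsElliptic] (hWd : ∃ C : VariableChange ℚ, C • W.quadraticTwist (NumberField.discr K : ℚ) = Wd)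
    (hSel : Nat.card (Wd.selmerGroup 2) = 2) {d : ℕ} (hDEF : padicValNat 2 Wd.tamagawaProduct = d)
    {m : ℕ} (hB2Q : ∀ (k : ℕ) (a : W.galH1), a ∈ W.sha → ((2 ^ k : ℕ) : ℤ) • a = 0 → ((2 ^ m : ℕ) : ℤ) • a = 0) :
    Nat.card (AddCommGroup.primaryComponent (W.baseChange K).sha 2) ∣ 2 ^ (2 * (m + d)) := by
  haveI : Fact (Nat.Prime 2) := ⟨Nat.prime_two⟩
  obtain ⟨τ, hτ, -⟩ := exists_conj_of_isImaginaryQuadratic (K := K) hIQ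
  obtain ⟨h2tors, hrk, ⟨yK, hndiv', hanti⟩, hT0⟩ :=
    exists_frame_of_cut W K hIQ hHe hs2 hτ Dt β ι d₁ hy M hndiv hw hrk0 Wd hWd hSel
  have hexp := forall_primaryComponent_sha_two_pow_smul_eq_zero_of_galH1 W hB2Q
  haveI := finite_primaryComponent_sha_rat_two_of_exponent W hexp
  obtain ⟨Cd, hCd⟩ := hWd
  obtain ⟨hne, hneT, hbud⟩ := relIndex_mul_relIndex_le_pow_of_padicValNat_eq W K hIQ hodd hHe hT Cd hCd hDEF
  -- `#Ш(E/ℚ)[2] ≤ #Sel₂(E/ℚ) ≤ 4`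
  have h4 : Nat.card (AddSubgroup.torsionBy (↥W.sha) ((2 : ℕ) : ℤ)) ≤ 4 := by
    have h := natCard_sha_torsionBy_dvd_natCard_selmerGroup W (n := 2) two_ne_zero
    simp only [Nat.cast_ofNat] at h
    have h' : Nat.card (AddSubgroup.torsionBy W.sha (2 : ℤ)) ∣ 4 := h.trans hSel4
    exact Nat.le_of_dvd (by norm_num) (by simpa using h')
  exact (natCard_sha_dvd_pow_add_of_pair_of_frame W K hIQ hτ h2tors hrk yK M hndiv' hanti hT0 hne hneT hbud hexp h4).2

/-- **X⁼²'s UPPER HALF HOLDS UP TO TWO BITS (LINE 24 sizing).**  Same frame with `Δ_W > 0`, `#Sel₂(E) = 4` (the STRICT cell lies here) and a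
defect-`2` minimal twin (`#Sel₂(Wd) = 2`, **`ord₂ C(Wd) = 2`**): with the `ℚ`-side exponent `m`, **`#Ш(E/K)[2^∞] ∣ 4^(m + 2)`**.  With B2Q
(`m = M₀`) and the lower half `4^(M₀) ∣ #Ш(E/K)[2^∞]` (road (E4)⁺, if it extends to defect 2) this pins `#Ш(E/K)[2^∞] ∈ {4^(M₀), 4^(M₀+1), 4^(M₀+2)}`
on the defect-2 cell; BSD predicts `4^(M₀)` (gk2-p5 g34 `Lossless` §2: `C(E/K) = C(E)²`).  So the exactness stub X⁼² of LINE 24 needs exactly the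
two identity-prime bits of the relaxed indices back (`i_q(E) = i_q(E^(d_K)) = 4` at the identity prime `q ∣ d_K`; to be cut by STRICT / `ρ_q = 2` via
a Kramer-exact count of the relaxed groups) — size L, NOT closed here.  [cite: Kramer1981, Thm. 1, Thm. 2, §2 Prop. 3] [cite: McCallumLMS1991, §5 Cor. 5.6] -/
theorem natCard_primaryComponent_sha_baseChange_two_dvd_pow_add_two_of_defectTwo
    (hT : Odd W.tamagawaProduct) (hIQ : IsImaginaryQuadratic K) (hodd : Odd (NumberField.discr K))
    (hHe : SatisfiesHeegnerHypothesis (W.conductorNorm ℤ) K) (hs2 : W.HasSurjectiveModNGaloisRep 2)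
    (Dt : ModularParametrizationData W (W.conductorNorm ℤ)) (β : ℤ) (ι : K →+* ℂ) (d₁ : KolyvaginHeegnerData Dt β ι 1)
    (hy : ¬ IsOfFinAddOrder d₁.derivedPoint) (M : ℕ)
    (hndiv : ¬ ∃ Q : (W.baseChange (ringClassField K ι 1)).toAffine.Point, ((2 ^ (M + 1) : ℕ) : ℤ) • Q = d₁.derivedPoint)
    (hw : W.rootNumber = 1) (hrk0 : W.mordellWeilRank = 0) (hSel4 : Nat.card (W.selmerGroup 2) = 4)
    (Wd : WeierstrassCurve ℚ) [Wd.IsElliptic] (hWd : ∃ C : VariableChange ℚ, C • W.quadraticTwist (NumberField.discr K : ℚ) = Wd)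
    (hSel : Nat.card (Wd.selmerGroup 2) = 2) (hDEF : padicValNat 2 Wd.tamagawaProduct = 2)
    {m : ℕ} (hB2Q : ∀ (k : ℕ) (a : W.galH1), a ∈ W.sha → ((2 ^ k : ℕ) : ℤ) • a = 0 → ((2 ^ m : ℕ) : ℤ) • a = 0) :
    Nat.card (AddCommGroup.primaryComponent (W.baseChange K).sha 2) ∣ 2 ^ (2 * (m + 2)) :=
  natCard_primaryComponent_sha_baseChange_two_dvd_pow_add_of_defect W K hT hIQ hodd hHe hs2 Dt β ι d₁ hy M hndiv hw hrk0
    (dvd_of_eq hSel4) Wd hWd hSel hDEF hB2Q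

end Defect

end Summit.BirchSwinnertonDyer.BirchSwinnertonDyer.Theorems.GenusExact.PlusDescent.DefectSizing

end
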